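import Literature.RepresentationTheory.HeisenbergGroup.ImplementerCocycle
import Mathlib.Analysis.Complex.Basic
import Mathlib.Analysis.Normed.Group.Basic
import Mathlib.Topology.Instances.ENNReal.Lemmas
import HarnessLib

/-!
# A normalised section of implementers with unitary cocycle is norm-preserving as soon as every symplectic element
# has SOME norm-preserving implementer (`Sp` has no characters)

Topic `RepresentationTheory/HeisenbergGroup`; namespace `Literature.RepresentationTheory.HeisenbergGroup`. KERNEL
ONLY: theorems; no definition, no named fact, no `sorry`.  Sequel of `ImplementerCocycle.lean` (the cocycle `c_r` of a
normalised section `r` of implementers of a model `ρ` of the Heisenberg group, `r(g) r(g') = c_r(g,g') r(gg')`).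

[Weil1964, Chap. I n° 13] / [MoeglinVignerasWaldspurger1987, Chap. 2 II.2]: the operators of the metaplectic group on the
Schrödinger model are UNITARY.  The abstract mechanism, for any «norm» `𝒩 : S → [0, ∞]` with `𝒩(c • f) = |c|² 𝒩(f)`,
non-zero and finite at one vector (the model case: `𝒩 = ‖·‖²_{L²}` on the Schwartz–Bruhat model,
`Automorphic/SchwartzBruhatL2Norm.lean`):

* §1 `exists_normSq_apply_eq_mul` — if `g` has an `𝒩`-preserving implementer then, implementers being unique up to
  scalars, `𝒩(r(g) f) = |λ_g|² 𝒩(f)` for one scalar `λ_g ∈ ℂˣ` and all `f` (the MODULUS of `r(g)`);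
* §2 `norm_modulus_mul` — if moreover `|c_r(g, g')| = 1` then `|λ_{gg'}| = |λ_g| |λ_{g'}|`: the modulus is a
  homomorphism `Sp(V, B) → ℝ_{>0}`;
* §3 **`normSq_apply_eq_of_monoidHom_eq_one`** — hence, if `Sp(V, B)` has no non-trivial homomorphism to `ℝˣ` (it is
  perfect: tree `monoidHom_symplecticGroup_gram_eq_one`, [Folland1989, Prop. (4.21)]), EVERY `r(g)` PRESERVES `𝒩`:
  a Leray/Rao-normalised section (cocycle an eighth root of unity, [MoeglinVignerasWaldspurger1987, Chap. 3 §I.3 rem. b)])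
  consists of unitary operators as soon as each `g` admits some unitary implementer — which for the Schrödinger model
  is [Weil1964, n° 13] on generators.

Written for the Hodge/COR-CM cell's Track 2 (GR-1): it reduces «the tree's local Weil representation
`ω_v = β⁻¹ · r ∘ ι` is `L²`-isometric» to the existence of isometric implementers and `|β| = 1`
(`GelbartRogawski1991/LocalSplittingIsometricCriterion.lean`).  Nothing is cited as a hypothesis.

## References
* [Weil1964] A. Weil, Acta Math. 111 (1964), Chap. I n° 13; Chap. III n° 34.
* [MoeglinVignerasWaldspurger1987] C. Mœglin, M.-F. Vignéras, J.-L. Waldspurger, LNM 1291 (1987), Chap. 2 II.1–II.2,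
  Chap. 3 §I.3 remarque b).
* [Folland1989] G. B. Folland, *Harmonic Analysis in Phase Space*, §4.1 Prop. (4.21).
-/

set_option autoImplicit false

noncomputable section

open scoped ENNReal NNReal

namespace Literature.RepresentationTheory.HeisenbergGroup

universe u v v'

variable {R : Type u} [CommRing R] [Invertible (2 : R)] {V : Type v} [AddCommGroup V] [Module R V]
  {B : V →ₗ[R] V →ₗ[R] R}
variable {S : Type v'} [AddCommGroup S] [Module ℂ S] {ρ : Representation ℂ (Heisenberg B) S}

namespace ImplementerSection

/-! ## §0 Bookkeeping between `‖·‖ₑ` and `‖·‖` on `ℂ` -/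

/-- `|a|ₑ² = |b|ₑ² ⇒ |a| = |b|` for complex numbers. [folklore] -/
private theorem norm_eq_norm_of_enorm_sq_eq {a b : ℂ} (h : ‖a‖ₑ ^ 2 = ‖b‖ₑ ^ 2) : ‖a‖ = ‖b‖ := by
  have h3 : (‖a‖₊ : ℝ≥0) ^ 2 = ‖b‖₊ ^ 2 := by
    rw [enorm_eq_nnnorm, enorm_eq_nnnorm, ← ENNReal.coe_pow, ← ENNReal.coe_pow, ENNReal.coe_inj] at h
    exact h
  have h4 : ‖a‖ ^ 2 = ‖b‖ ^ 2 := by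
    have := congrArg (fun t : ℝ≥0 => (t : ℝ)) h3
    simpa only [NNReal.coe_pow, coe_nnnorm] using this
  exact (pow_left_inj₀ (norm_nonneg _) (norm_nonneg _) two_ne_zero).1 h4

/-- `|c|ₑ = 1` for `|c| = 1`. [folklore] -/
private theorem enorm_eq_one_of_norm_eq_one {c : ℂ} (h : ‖c‖ = 1) : ‖c‖ₑ = 1 := by
  rw [← ofReal_norm, h, ENNReal.ofReal_one]

/-- cancelling a non-zero finite factor on the right in `ℝ≥0∞`. [folklore] -/
private theorem mul_right_cancel_ennreal {a b n : ℝ≥0∞} (h0 : n ≠ 0) (htop : n ≠ ∞) (h : a * n = b * n) : a = b :=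
  (ENNReal.mul_left_inj h0 htop).1 h

variable (r : ImplementerSection ρ) (hU : ImplementerUniqueUpToScalar ρ)
  (𝒩 : S → ℝ≥0∞) (h𝒩 : ∀ (c : ℂ) (f : S), 𝒩 (c • f) = ‖c‖ₑ ^ 2 * 𝒩 f)

/-! ## §1 The modulus of `r(g)` -/

include hU h𝒩 in
/-- **the modulus of `r(g)`**: if `g` has an `𝒩`-preserving implementer `M`, then `r(g) = λ • M` for a scalar
`λ ∈ ℂˣ` (uniqueness of implementers up to scalars) and `𝒩(r(g) f) = |λ|² 𝒩(f)` for all `f`.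
[cite: MoeglinVignerasWaldspurger1987, Chap. 2 II.1 (A)] -/
theorem exists_normSq_apply_eq_mul (g : symplecticGroup B)
    (hE : ∃ M : S ≃ₗ[ℂ] S, Implements ρ (ofSymplectic B g) M ∧ ∀ f, 𝒩 (M f) = 𝒩 f) :
    ∃ c : ℂˣ, ∀ f, 𝒩 (r g f) = ‖(c : ℂ)‖ₑ ^ 2 * 𝒩 f := by
  obtain ⟨M, hM, hMn⟩ := hE
  obtain ⟨c, hc⟩ := hU g M (r g) hM (r.implements g)
  exact ⟨c, fun f => by rw [hc f, h𝒩, hMn]⟩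

/-! ## §2 With a unitary cocycle the modulus is multiplicative -/

variable [Nontrivial S] {f₀ : S} (h0 : 𝒩 f₀ ≠ 0) (htop : 𝒩 f₀ ≠ ∞)

include hU h𝒩 h0 htop in
/-- **multiplicativity of the modulus**: if `𝒩(r(g) f) = |λ_g|² 𝒩(f)` for all `f` (each `g`), and the cocycle is
unitary, `|c_r(g, g')| = 1`, then `|λ_{gg'}| = |λ_g| |λ_{g'}|` — read `r(g) r(g') f₀ = c_r(g,g') r(gg') f₀` through `𝒩` and
cancel `0 < 𝒩(f₀) < ∞`. [cite: MoeglinVignerasWaldspurger1987, Chap. 2 II.1 (B)] -/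
theorem norm_modulus_mul (lam : symplecticGroup B → ℂˣ) (hlam : ∀ g f, 𝒩 (r g f) = ‖(lam g : ℂ)‖ₑ ^ 2 * 𝒩 f)
    (hc : ∀ g g', ‖((r.cocycle hU g g' : ℂˣ) : ℂ)‖ = 1) (g g' : symplecticGroup B) :
    ‖(lam (g * g') : ℂ)‖ = ‖(lam g : ℂ)‖ * ‖(lam g' : ℂ)‖ := by
  have e : 𝒩 (r g (r g' f₀)) = 𝒩 ((r.cocycleFun hU g g' : ℂ) • r (g * g') f₀) := by rw [r.mul_apply hU]
  rw [hlam g, hlam g', h𝒩, hlam (g * g'), ← r.cocycle_apply hU, enorm_eq_one_of_norm_eq_one (hc g g'), one_pow,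
    one_mul, ← mul_assoc] at e
  have e2 : ‖(lam g : ℂ)‖ₑ ^ 2 * ‖(lam g' : ℂ)‖ₑ ^ 2 = ‖(lam (g * g') : ℂ)‖ₑ ^ 2 := mul_right_cancel_ennreal h0 htop e
  rw [← mul_pow, ← enorm_mul] at e2
  rw [← norm_mul]
  exact (norm_eq_norm_of_enorm_sq_eq e2).symm

/-! ## §3 No characters of `Sp` ⇒ the section preserves `𝒩` -/

include hU h𝒩 h0 htop in
/-- **A normalised section with unitary cocycle over a symplectic group without characters to `ℝˣ` preserves the norm
as soon as every element has SOME norm-preserving implementer.**  With `λ_g` the modulus of §1, `g ↦ |λ_g| ∈ ℝˣ` is a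
homomorphism by §2, hence trivial; so `𝒩(r(g) f) = 𝒩(f)` for all `g`, `f`.  Model case: the Leray–Rao section of the
Schrödinger model of a non-archimedean local field (cocycle an eighth root of unity) consists of `L²`-unitary operators
([Weil1964, n° 13]; `Sp` perfect, [Folland1989, Prop. (4.21)]). [cite: Weil1964, Chap. I n° 13]
[cite: MoeglinVignerasWaldspurger1987, Chap. 2 II.2] -/
theorem normSq_apply_eq_of_monoidHom_eq_one
    (hE : ∀ g : symplecticGroup B, ∃ M : S ≃ₗ[ℂ] S, Implements ρ (ofSymplectic B g) M ∧ ∀ f, 𝒩 (M f) = 𝒩 f)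
    (hc : ∀ g g', ‖((r.cocycle hU g g' : ℂˣ) : ℂ)‖ = 1)
    (htriv : ∀ χ : symplecticGroup B →* ℝˣ, χ = 1) (g : symplecticGroup B) (f : S) : 𝒩 (r g f) = 𝒩 f := by
  have hlam : ∀ g : symplecticGroup B, ∃ c : ℂˣ, ∀ f, 𝒩 (r g f) = ‖(c : ℂ)‖ₑ ^ 2 * 𝒩 f :=
    fun g => r.exists_normSq_apply_eq_mul hU 𝒩 h𝒩 g (hE g)
  choose lam hlam using hlam
  have hmul := r.norm_modulus_mul hU 𝒩 h𝒩 h0 htop lam hlam hc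
  -- the modulus homomorphism `g ↦ |λ_g| ∈ ℝˣ`
  let χ : symplecticGroup B →* ℝˣ := MonoidHom.mk'
    (fun g => Units.mk0 ‖(lam g : ℂ)‖ (norm_ne_zero_iff.2 (lam g).ne_zero)) (fun a b => Units.ext (hmul a b))
  have h1 : ‖(lam g : ℂ)‖ = 1 := by
    have := DFunLike.congr_fun (htriv χ) g
    have h2 : ((χ g : ℝˣ) : ℝ) = 1 := by rw [this]; rfl
    exact h2
  rw [hlam g f, enorm_eq_one_of_norm_eq_one h1, one_pow, one_mul]

include hU h𝒩 h0 htop in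
/-- the same for the operators `a • r(g)`, `|a| = 1` (the image of the twisted product `Sp ×_c 𝕋`, or a splitting
`β(g)⁻¹ r(ι g)` with `|β| = 1`). [cite: Weil1964, Chap. I n° 13] -/
theorem normSq_smul_apply_eq_of_monoidHom_eq_one
    (hE : ∀ g : symplecticGroup B, ∃ M : S ≃ₗ[ℂ] S, Implements ρ (ofSymplectic B g) M ∧ ∀ f, 𝒩 (M f) = 𝒩 f)
    (hc : ∀ g g', ‖((r.cocycle hU g g' : ℂˣ) : ℂ)‖ = 1)
    (htriv : ∀ χ : symplecticGroup B →* ℝˣ, χ = 1) (g : symplecticGroup B) {a : ℂ} (ha : ‖a‖ = 1) (f : S) :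
    𝒩 (a • r g f) = 𝒩 f := by
  rw [h𝒩, enorm_eq_one_of_norm_eq_one ha, one_pow, one_mul,
    r.normSq_apply_eq_of_monoidHom_eq_one hU 𝒩 h𝒩 h0 htop hE hc htriv]

end ImplementerSection

end Literature.RepresentationTheory.HeisenbergGroup

end
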